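import Summits.SmoothPoincare4.SmoothPoincare4.Theorems.DottedCircleRasmussenDcrGapHelperFriendsCarrierVkPartAPartIGeo
import Summits.SmoothPoincare4.SmoothPoincare4.Theorems.DottedCircleRasmussenDcrGapHelperFriendsCarrierVkPartAPartITransfer
import Summits.SmoothPoincare4.SmoothPoincare4.Theorems.DottedCircleRasmussenDcrGapHelperFriendsCarrierVkPartAPartIWinding

/-!
# Helper `helper_friendsCarrier_Vk_partA_partI` (V_k part A, part I: THE TUBE FRAMING IS THE SEIFERT FRAMING)
of line `mk_friends`, crux `DcrGap` (item stmt-SmoothPoincare4-16128, route route-SmoothPoincare4-DottedCircleRasmussen)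

**Statement.** For a null-homologous model knot `K₁ ⊂ M_k = ∂D_k` off the cores and a tube `νK : 𝕊¹ × ℝ² → M_k`
of `K₁` (`C^∞`, injective, immersive, zero section `K₁`, off the cores) whose standard picture
`P = toSphereThree ∘ draw k` is, on the unit disc bundle, the `r`-scaled `0`-framed tube `ν'` of the picture knot
`J`, every push-off `t ↦ νK(e^{2πit}, s e₀)`, `s > 0`, has Hurewicz class `0` in `H₁({y ∈ M_k | y ∉ K₁}; ℤ)`.

**Proof** (the nine landed pieces `…PartAPartI{Picture, CollarIn, CollarOut, Partition, Functionals, Loops,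
GeoValues, Geo, Transfer, Winding}`).  Fix `ε = min(1/40, min |w ∘ K₁|²)` and replace `s` by `s' = min(s, ½)`
(`loopClass_pushOff_eq`).  In `S³ ∖ J` the loop `ℓ = P ∘ (push-off at radius s')` is the push-off of `ν'` at
radius `r s'`, null-homologous since `ν'` is `0`-framed (`loopClass_radius_longitude_eq_zero`).  Mayer–Vietoris for
the open cover `S³ ∖ J = (V ∖ J) ∪ O`, `V = P(M_k ∖ cores)`, `O = S³ ∖ P(M_k ∩ {|w|² ≥ ε})` (piece Picture: `V` open,
the removed set compact, `V ∩ O = W` the collar), lifts the class of `ℓ` in `H₁(V ∖ J)` to a class `d` of the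
collar `W` dying in `O` (piece Transfer).  The planar windings of `d` about the holes are those of `ℓ`, which vanish
(`IsNullHomologous`, piece Winding), so by the bookkeeping of piece Geo `d = b · h(B)` for the fibre circle `B` of
the outer core.  Pull back along the chart lift `P⁻¹ : V ∖ J → M_k ∖ K₁` (continuous, piece Picture): the class of
the push-off in `M_k ∖ K₁` is `b · h(P⁻¹ ∘ B)`, and `P⁻¹ ∘ B`, the `w`-circle about the outer core, bounds its
normal disc (`loopClass_outerFibre_eq_zero`, piece Transfer).

* `helper_friendsCarrier_Vk_partA_partI` — the registered stub, verbatim.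

No definitions, no named facts, no `sorry`.

## References

* R. Kirby, *The Topology of 4-Manifolds*, LNM 1374 (1989), Ch. I §2, Lemma 2.1. [Kirby1989]
* D. Rolfsen, *Knots and Links* (1976), §5.D, §9.F. [Rolfsen1976]
* A. Hatcher, *Algebraic Topology*, CUP (2002), §2.2, Prop. 2.6, Thm. 2A.1. [HatcherAT2002]
-/

set_option linter.dupNamespace false
set_option linter.style.longLine false

noncomputable section

open scoped Manifold ContDiff Topology unitInterval
open Function Set Metric TopologicalSpace Literature.Topology.FourManifolds Literature.Topology.FourManifolds.MMSW Literature.AlgebraicTopology.Homotopy.HopfFibration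
  Literature.AlgebraicTopology.SingularHomology Literature.AlgebraicTopology.FundamentalGroup.PuncturedPlane

namespace Summit.SmoothPoincare4.SmoothPoincare4.Theorems.DcrGap.MkFriends

open FriendsCarrierVk in
/-- **Part I of the split of `helper_friendsCarrier_Vk_partA` — the tube framing is the Seifert framing.**  For a
null-homologous model knot `K₁ ⊂ M_k` off the cores and a tube `νK : 𝕊¹ × ℝ² → M_k` of `K₁` whose picture is, on
the unit disc bundle, a rescaled `0`-framed tubular neighbourhood `ν'` of the picture knot `J`, every push-off
`t ↦ νK(e^{2πit}, s e₀)`, `s > 0`, is null-homologous in `M_k ∖ K₁` (Hurewicz class `0` in `H₁(M_k ∖ K₁; ℤ)`).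
[cite: Kirby1989, Ch. I §2, Lemma 2.1] [cite: Rolfsen1976, §5.D] -/
theorem helper_friendsCarrier_Vk_partA_partI : ∀ (k : ℕ) (K₁ : (sphere (0 : EuclideanSpace ℝ (Fin 2)) 1) → EuclideanSpace ℝ (Fin 4)) (νK : (sphere (0 : EuclideanSpace ℝ (Fin 2)) 1) × EuclideanSpace ℝ (Fin 2) → EuclideanSpace ℝ (Fin 4)), IsModelKnot k K₁ → ContMDiff ((𝓡 1).prod 𝓘(ℝ, EuclideanSpace ℝ (Fin 2))) 𝓘(ℝ, EuclideanSpace ℝ (Fin 4)) ∞ νK → Injective νK → (∀ p, Injective (mfderiv ((𝓡 1).prod 𝓘(ℝ, EuclideanSpace ℝ (Fin 2))) 𝓘(ℝ, EuclideanSpace ℝ (Fin 4)) νK p)) → (∀ p, νK p ∈ modelBoundary k) → (∀ u : (sphere (0 : EuclideanSpace ℝ (Fin 2)) 1), νK (u, 0) = K₁ u) → IsNullHomologous k K₁ → (∀ t, wC (K₁ t) ≠ 0) → ∀ (J : Knot) (ν' : Knot.TubularNbhd J) (r : ℝ), (∀ p, wC (νK p) ≠ 0) → ν'.HasFraming 0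 → 0 < r → (∀ (u : (sphere (0 : EuclideanSpace ℝ (Fin 2)) 1)) (w : EuclideanSpace ℝ (Fin 2)), ‖w‖ < 1 → toSphereThree (draw k (νK (u, w))).1 (draw k (νK (u, w))).2 = ν' (u, r • w)) → ∀ (s : ℝ), 0 < s → ∀ (p : ↥{y : EuclideanSpace ℝ (Fin 4) | y ∈ modelBoundary k ∧ y ∉ range K₁}) (γ : Path p p), (∀ t, ((γ t : ↥{y : EuclideanSpace ℝ (Fin 4) | y ∈ modelBoundary k ∧ y ∉ range K₁}) : EuclideanSpace ℝ (Fin 4)) = νK (circlePoint (2 * Real.pi * t), s • EuclideanSpace.single 0 1)) → Literature.AlgebraicTopology.SingularHomology.loopClass ℤ ℤ (1 : ℤ) γ = 0 := by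
  intro k K₁ νK hK hν hνinj _ hνM hν0 hN hw J ν' r hwν hfr hr hpic s hs p γ hγ
  have hνc : Continuous νK := hν.continuous
  have hKc : Continuous K₁ := hK.1.continuous
  -- the parameter `ε`
  obtain ⟨u₀, -, hu₀⟩ := (isCompact_univ (X := sphere (0 : EuclideanSpace ℝ (Fin 2)) 1)).exists_isMinOn univ_nonempty
    ((continuous_wC.comp hKc).norm.pow 2).continuousOn
  set ε : ℝ := min (1 / 40) (‖wC (K₁ u₀)‖ ^ 2) with hεdef
  have hεK : ∀ u, ε ≤ ‖wC (K₁ u)‖ ^ 2 := fun u => (min_le_right _ _).trans (hu₀ (mem_univ u))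
  have hε : 0 < ε := lt_min (by norm_num) (by have := hw u₀; positivity)
  have hε40 : ε ≤ 1 / 40 := min_le_left _ _
  -- the radius `s'`
  set s' : ℝ := min s (1 / 2) with hs'def
  have hs' : 0 < s' := lt_min hs (by norm_num)
  have hs'1 : s' < 1 := (min_le_right _ _).trans_lt (by norm_num)
  -- the sets
  set Vp : Set (sphere (0 : EuclideanSpace ℝ (Fin 4)) 1) := (fun x : EuclideanSpace ℝ (Fin 4) => stereoNorthInv (draw k x)) ''
    {x | x ∈ modelBoundary k ∧ wC x ≠ 0} with hVp
  set O : Set (sphere (0 : EuclideanSpace ℝ (Fin 4)) 1) := ((fun x : EuclideanSpace ℝ (Fin 4) => stereoNorthInv (draw k x)) ''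
    {x | x ∈ modelBoundary k ∧ ε ≤ ‖wC x‖ ^ 2})ᶜ with hO
  set W : Set (sphere (0 : EuclideanSpace ℝ (Fin 4)) 1) := (fun x : EuclideanSpace ℝ (Fin 4) => stereoNorthInv (draw k x)) ''
    {x | x ∈ modelBoundary k ∧ wC x ≠ 0 ∧ ‖wC x‖ ^ 2 < ε} with hW
  have hWeq : Vp ∩ O = W := pic_inter_compl_eq hε
  have hWO : W ⊆ O := fun y hy => (hWeq ▸ hy : y ∈ Vp ∩ O).2
  have hWV : W ⊆ Vp := fun y hy => (hWeq ▸ hy : y ∈ Vp ∩ O).1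
  have hJO : ∀ u, J u ∉ O := fun u h => h ⟨K₁ u, ⟨hK.mem u, hεK u⟩, pic_knot_eq hν0 hpic u⟩
  -- the Mayer–Vietoris cover of `S³ ∖ J`
  set U' : Set ↥J.complement := {y | (y : sphere (0 : EuclideanSpace ℝ (Fin 4)) 1) ∈ Vp} with hU'
  set V' : Set ↥J.complement := {y | (y : sphere (0 : EuclideanSpace ℝ (Fin 4)) 1) ∈ O} with hV'
  have hUo : IsOpen U' := pic_isOpen_image.preimage continuous_subtype_val
  have hVo : IsOpen V' := (pic_isCompact_image_ge hε).isClosed.isOpen_compl.preimage continuous_subtype_val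
  have hsubV : (fun x : EuclideanSpace ℝ (Fin 4) => stereoNorthInv (draw k x)) '' {x | x ∈ modelBoundary k ∧ ε ≤ ‖wC x‖ ^ 2} ⊆ Vp :=
    image_mono fun x hx => ⟨hx.1, fun h0 => by
      have h2 : ε ≤ ‖wC x‖ ^ 2 := hx.2
      rw [h0, norm_zero] at h2; simp at h2; linarith⟩
  have hcov : U' ∪ V' = univ := by
    refine eq_univ_of_forall fun y => ?_
    by_cases h : (y : sphere (0 : EuclideanSpace ℝ (Fin 4)) 1) ∈ O
    · exact Or.inr h
    · exact Or.inl (hsubV (not_notMem.1 h))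
  -- the push-off of radius `s'` in the picture and in `M_k ∖ K₁`
  have hsingle : s' • (EuclideanSpace.single 0 1 : EuclideanSpace ℝ (Fin 2)) = s' • ((circlePoint 0 : sphere (0 : EuclideanSpace ℝ (Fin 2)) 1) : EuclideanSpace ℝ (Fin 2)) := by
    rw [circlePoint_zero_eq_single]
  have hnorm : ‖s' • (EuclideanSpace.single 0 1 : EuclideanSpace ℝ (Fin 2))‖ < 1 := by
    rw [hsingle, norm_smul, norm_eq_of_mem_sphere, mul_one, Real.norm_of_nonneg hs'.le]; exact hs'1
  have hP : ∀ t : ℝ, stereoNorthInv (draw k (νK (circlePoint (2 * Real.pi * t), s' • EuclideanSpace.single 0 1))) =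
      ν' (circlePoint (2 * Real.pi * t), (r * s') • ((circlePoint 0 : sphere (0 : EuclideanSpace ℝ (Fin 2)) 1) : EuclideanSpace ℝ (Fin 2))) := fun t => by
    rw [← toSphereThree_eq_stereoNorthInv, hpic _ _ hnorm, hsingle, smul_smul]
  have hmemV : ∀ t : ℝ, stereoNorthInv (draw k (νK (circlePoint (2 * Real.pi * t), s' • EuclideanSpace.single 0 1))) ∈ Vp := fun t =>
    ⟨_, ⟨hνM _, hwν _⟩, rfl⟩
  have hmemJ : ∀ t : ℝ, stereoNorthInv (draw k (νK (circlePoint (2 * Real.pi * t), s' • EuclideanSpace.single 0 1))) ∈ J.complement := fun t => by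
    rw [hP]; exact ν'.apply_mem_compl_range (smul_ne_zero (mul_pos hr hs').ne' (ne_zero_of_mem_unit_sphere _))
  have hend : circlePoint (2 * Real.pi * (1 : ℝ)) = circlePoint (2 * Real.pi * (0 : ℝ)) := by
    rw [mul_one, mul_zero, ← zero_add (2 * Real.pi), circlePoint_add_two_pi]
  have hcirc : Continuous fun t : I => ((circlePoint (2 * Real.pi * (t : ℝ)), s' • EuclideanSpace.single 0 1) :
      (sphere (0 : EuclideanSpace ℝ (Fin 2)) 1) × EuclideanSpace ℝ (Fin 2)) :=
    (continuous_circlePoint.comp (continuous_const.mul continuous_subtype_val)).prodMk continuous_const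
  let ℓU : Path (⟨⟨_, hmemJ 0⟩, hmemV 0⟩ : ↥U') ⟨⟨_, hmemJ 0⟩, hmemV 0⟩ :=
    { toFun := fun t => ⟨⟨_, hmemJ t⟩, hmemV t⟩
      continuous_toFun := ((pic_continuousOn_P.comp_continuous (hνc.comp hcirc) fun t => hwν _).subtype_mk _).subtype_mk _
      source' := rfl
      target' := by
        apply Subtype.ext; apply Subtype.ext
        show stereoNorthInv _ = stereoNorthInv _
        simp only [Set.Icc.coe_one]; rw [hend] }
  set c : singularHomology ℤ ℤ ↥U' 1 := loopClass ℤ ℤ (1 : ℤ) ℓU with hc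
  have hc0 : singularHomology.map ℤ ℤ (subsetIncl U') 1 c = 0 := by
    rw [hc, map_loopClass]
    exact loopClass_radius_longitude_eq_zero ν' hfr (mul_pos hr hs') _ fun t => hP t
  -- Mayer–Vietoris and transport to the collar
  obtain ⟨e, he1, he2⟩ := mv_exists_of_map_eq_zero U' V' hUo hVo hcov c hc0
  have hgWmem : ∀ y : ↥(U' ∩ V'), ((y : ↥J.complement) : sphere (0 : EuclideanSpace ℝ (Fin 4)) 1) ∈ W := fun y => by
    rw [← hWeq]; exact y.2
  let gW : C(↥(U' ∩ V'), ↥W) := ⟨fun y => ⟨_, hgWmem y⟩, (continuous_subtype_val.comp continuous_subtype_val).subtype_mk _⟩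
  set d : singularHomology ℤ ℤ ↥W 1 := singularHomology.map ℤ ℤ gW 1 e with hd
  have hdO : singularHomology.map ℤ ℤ (subsetInclusion hWO) 1 d = 0 := by
    let gO : C(↥V', ↥O) := ⟨fun y => ⟨_, y.2⟩, (continuous_subtype_val.comp continuous_subtype_val).subtype_mk _⟩
    have : (subsetInclusion hWO).comp gW = gO.comp (subsetInclusion inter_subset_right) := by ext y; rfl
    rw [hd, ← ModuleCat.comp_apply, ← singularHomology.map_comp, this, singularHomology.map_comp, ModuleCat.comp_apply, he2, map_zero]
  have hκmem : ∀ y : ↥W, ((y : sphere (0 : EuclideanSpace ℝ (Fin 4)) 1) ∈ J.complement) := fun y => by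
    rintro ⟨u, hu⟩; exact hJO u (hu ▸ hWO y.2)
  let κ : C(↥W, ↥U') := ⟨fun y => ⟨⟨_, hκmem y⟩, hWV y.2⟩, (continuous_subtype_val.subtype_mk _).subtype_mk _⟩
  have hκd : singularHomology.map ℤ ℤ κ 1 d = c := by
    have : κ.comp gW = subsetInclusion inter_subset_left := by ext y; rfl
    rw [hd, ← ModuleCat.comp_apply, ← singularHomology.map_comp, this, he1]
  -- the planar windings of `d` vanish
  have hwind : ∀ (j : Fin k) (f : C(↥W, CStar)), (∀ y : ↥W, ((f y : CStar) : ℂ) =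
      chartZ k (stereoNorthCoords ((y : sphere (0 : EuclideanSpace ℝ (Fin 4)) 1) : EuclideanSpace ℝ (Fin 4))) - holeCentre k j) →
      singularHomology.map ℤ ℤ f 1 d = 0 := by
    intro j f hf
    have hne : ∀ y : ↥U', chartZ k (stereoNorthCoords (((y : ↥J.complement) : sphere (0 : EuclideanSpace ℝ (Fin 4)) 1) : EuclideanSpace ℝ (Fin 4))) - holeCentre k j ≠ 0 := by
      intro y
      obtain ⟨-, hreg⟩ := (pic_mem_image_iff _).1 (show ((y : ↥J.complement) : sphere (0 : EuclideanSpace ℝ (Fin 4)) 1) ∈ Vp from y.2)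
      have := hreg.2.1 j
      intro h0; rw [sub_eq_zero.1 h0, sub_self, map_zero] at this; exact absurd this (by norm_num)
    have hZ : Continuous (chartZ k) := by unfold chartZ chartC; fun_prop
    have hcont : Continuous fun y : ↥U' => chartZ k (stereoNorthCoords (((y : ↥J.complement) : sphere (0 : EuclideanSpace ℝ (Fin 4)) 1) : EuclideanSpace ℝ (Fin 4))) :=
      hZ.comp (pic_continuousOn_coords.comp_continuous (continuous_subtype_val.comp continuous_subtype_val) fun y =>
        ((pic_mem_image_iff _).1 (show ((y : ↥J.complement) : sphere (0 : EuclideanSpace ℝ (Fin 4)) 1) ∈ Vp from y.2)).1)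
    let F : C(↥U', CStar) := ⟨fun y => ⟨_, hne y⟩, (hcont.sub continuous_const).subtype_mk _⟩
    have hfac : f = F.comp κ := by ext y; exact hf y
    rw [hfac, singularHomology.map_comp, ModuleCat.comp_apply, hκd, hc, map_loopClass]
    refine loopClass_planarWinding_eq_zero K₁ νK hKc hνc hνM hν0 hN j s' _ fun t => ?_
    show chartZ k (stereoNorthCoords ((stereoNorthInv (draw k (νK (circlePoint (2 * Real.pi * t), s' • EuclideanSpace.single 0 1))) :
      sphere (0 : EuclideanSpace ℝ (Fin 4)) 1) : EuclideanSpace ℝ (Fin 4))) - holeCentre k j = _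
    rw [pic_coords_P, chartZ_draw (hνM _) (hwν _)]
  -- the bookkeeping in the picture
  obtain ⟨b, z₁, pB, B, -, hz₁co, hz₁lat, hz₁ann, hz₁pot, hB, hdB⟩ :=
    helper_friendsCarrier_Vk_partA_partI_geo k ε hε hε40 W O hWO rfl rfl d hdO hwind
  -- back to `M_k ∖ K₁` along the chart lift
  have hRmem : ∀ y : ↥U', chartLift k (stereoNorthCoords (((y : ↥J.complement) : sphere (0 : EuclideanSpace ℝ (Fin 4)) 1) : EuclideanSpace ℝ (Fin 4))) ∈
      {y : EuclideanSpace ℝ (Fin 4) | y ∈ modelBoundary k ∧ y ∉ range K₁} := by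
    intro y
    obtain ⟨hNP, hreg⟩ := (pic_mem_image_iff _).1 (show ((y : ↥J.complement) : sphere (0 : EuclideanSpace ℝ (Fin 4)) 1) ∈ Vp from y.2)
    refine ⟨chartLift_mem_modelBoundary hreg, ?_⟩
    rintro ⟨u, hu⟩
    have h1 := pic_P_lift hNP hreg
    rw [← hu, pic_knot_eq hν0 hpic u] at h1
    exact (y : ↥J.complement).2 ⟨u, h1⟩
  let R : C(↥U', ↥{y : EuclideanSpace ℝ (Fin 4) | y ∈ modelBoundary k ∧ y ∉ range K₁}) :=
    ⟨fun y => ⟨_, hRmem y⟩, (pic_continuousOn_lift.comp_continuous (continuous_subtype_val.comp continuous_subtype_val) fun y => y.2).subtype_mk _⟩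
  have hRc : singularHomology.map ℤ ℤ R 1 c = 0 := by
    rw [← hκd, hdB, map_zsmul, map_zsmul, map_loopClass, map_loopClass]
    rw [loopClass_outerFibre_eq_zero hε hε40 K₁ hεK z₁ hz₁co hz₁lat hz₁ann hz₁pot _ fun t => ?_, zsmul_zero]
    show chartLift k (stereoNorthCoords (((B t : ↥W) : sphere (0 : EuclideanSpace ℝ (Fin 4)) 1) : EuclideanSpace ℝ (Fin 4))) = _
    rw [(hB t).2, pic_lift_P (hB t).1 (by rw [wC_ofZW]; exact ((geo_half_sqrt hε).2.2 _).2)]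
  -- the push-off of radius `s'` and the given one
  have hmemX : ∀ t : ℝ, νK (circlePoint (2 * Real.pi * t), s' • EuclideanSpace.single 0 1) ∈ {y : EuclideanSpace ℝ (Fin 4) | y ∈ modelBoundary k ∧ y ∉ range K₁} := fun t => by
    have := hRmem (ℓU ⟨0, by norm_num, by norm_num⟩)
    refine ⟨hνM _, ?_⟩
    rintro ⟨u, hu⟩
    rw [← hν0] at hu
    have h2 := congrArg (fun v : EuclideanSpace ℝ (Fin 2) => v 0) (congrArg Prod.snd (hνinj hu))
    simp at h2; linarith
  let γ' : Path (⟨_, hmemX 0⟩ : ↥{y : EuclideanSpace ℝ (Fin 4) | y ∈ modelBoundary k ∧ y ∉ range K₁}) ⟨_, hmemX 0⟩ :=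
    { toFun := fun t => ⟨_, hmemX t⟩
      continuous_toFun := (hνc.comp hcirc).subtype_mk _
      source' := rfl
      target' := by apply Subtype.ext; show νK _ = νK _; simp only [Set.Icc.coe_one]; rw [hend] }
  have hγ' : loopClass ℤ ℤ (1 : ℤ) γ' = 0 := by
    rw [← hRc, hc, map_loopClass]
    refine loopClass_congr_fun fun t => Subtype.ext ?_
    show νK _ = chartLift k (stereoNorthCoords ((stereoNorthInv (draw k (νK (circlePoint (2 * Real.pi * t), s' • EuclideanSpace.single 0 1))) :
      sphere (0 : EuclideanSpace ℝ (Fin 4)) 1) : EuclideanSpace ℝ (Fin 4)))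
    rw [pic_lift_P (hνM _) (hwν _)]
  rw [loopClass_pushOff_eq K₁ νK hνc hνinj hνM hν0 hs hs' γ γ' hγ (fun t => rfl)]
  exact hγ'

end Summit.SmoothPoincare4.SmoothPoincare4.Theorems.DcrGap.MkFriends
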